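import Mathlib
import Summits.MatrixMultiplication.MatrixMultiplication.Theses.FourierTwoFamiliesModP
import Summits.MatrixMultiplication.MatrixMultiplication.Theorems.PrimeTwoFamilies.Negative.Slices

/-!
# Crux `PrimeTwoFamilies` (stmt-MatrixMultiplication-14308), line `Sketch` — stub `stub_capacityTransfer`
# by EXPLICIT DIGIT DESIGNS (elementary route)

The registered stub `stub_capacityTransfer` of the capacity form of line `Sketch`: CAPACITY GADGETS
(for every `ε > 0` and arbitrarily large `m`, direct pairs `(P c, Q c)_{c<r}` in `ℤ/m` of co-volume
`|P c||Q c| ≥ m^{1-ε}` and a zero-error code `W` of words `Fin L → Fin r`, `L ≥ 1`,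
`|W| ≥ (m^L)^{1/2-ε}`) give every slice `0 < δ ≤ 1` of the crux (`PrimeTwoFamiliesAt δ`: arbitrarily
large `n`, a prime `p ≤ n^{2+δ}`, `n` SDPP pairs in `ℤ/p` of co-volume `≥ n^{2-δ}`).

This file gives a second, self-contained and fully explicit proof (the first, `CapacityLift.stub_capacityTransfer`,
lifts to the group `Fin L → ℤ/m` and then moves the lifted family by the abstract carry-free transfer
`exists_prime_sdpp_of_addEquiv`, a Freiman isomorphism of order 3).  Here the SDPP family in the prime
cyclic group is WRITTEN DOWN: it is the radix-`2m` DIGIT DESIGN over the gadget alphabet,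

  `A_w = { Σ_t val(x_t) (2m)^t mod p : x_t ∈ P (w t) }`,  `B_w = { Σ_t val(y_t) (2m)^t mod p : y_t ∈ Q (w t) }`,

`w ∈ W`, `p` a Bertrand prime in `((2m)^L, 2 (2m)^L]`.  The only tool is UNIQUENESS OF BASE-`2m` DIGITS
(`finFunctionFinEquiv` of Mathlib): a two-fold sum `Φ x + Φ y` has digits `val(x_t) + val(y_t) < 2m`, so
the digit map `Φ` reflects two-fold sums coordinatewise (`digitMap_reflect`), and clauses (W), (X) of the
route follow letter by letter from directness and strong separation (`digitDesign_sdpp`) — no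
intermediate family, no equivalence of groups, no Freiman machinery.  The exponent bookkeeping is explicit
too (`digit_bookkeeping`): `ε = δ/16`, gadget level `m ≥ max (n₀³) ⌈32^{4/δ}⌉₊`, kept pairs
`n = max n₀ ⌈p^{1/(2+δ)}⌉₊`; the three inequalities `n ≤ |W|`, `p ≤ n^{2+δ}`, `n^{2-δ} ≤ (m^{1-ε})^L`
reduce to `8 · 4^L ≤ (m^L)^{δ(6-δ)/16}`, i.e. to `32 ≤ m^{δ/4}`.

Contents
* `digits_lt`, `digits_injective` — base-`b` expansions with digits `< b` are `< b^L` and unique.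
* `digitMap_reflect` — `Φ x = Σ_t val(x t) (2m)^t (mod p)`, `(2m)^L < p`, reflects two-fold sums.
* `digitDesign_sdpp` — images of the product blocks of separated words under a sum-reflecting map are
  SDPP pairs (clauses (W), (X) verbatim as in the route) of co-volume `∏_t |P (w t)||Q (w t)|`.
* `exists_injective_mem` — `n ≤ |W|` words of the code, injectively.
* `digit_bookkeeping` — the explicit exponent bookkeeping, uniform in the word length `L ≥ 1`.
* `stub_capacityTransfer` — the registered stub, verbatim signature.

Helper file landed `--supports stmt-MatrixMultiplication-14308` (siege k18, variation explicit/elementary);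
no new definitions.
-/

-- single-conjunct summit: the mandated namespace repeats `MatrixMultiplication`.
set_option linter.dupNamespace false

namespace Summit.MatrixMultiplication.MatrixMultiplication.Theorems.PrimeTwoFamilies.DigitTransfer

open Finset
open Summit.MatrixMultiplication.MatrixMultiplication.Theses
open Summit.MatrixMultiplication.MatrixMultiplication.Theorems.PrimeTwoFamilies.Negative

/-! ## Base-`b` digits -/

/-- A base-`b` expansion of length `L` with digits `< b` is `< b ^ L` (Mathlib's
`finFunctionFinEquiv : (Fin L → Fin b) ≃ Fin (b ^ L)` is literally `d ↦ Σ_t d_t b^t`). -/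
theorem digits_lt {b L : ℕ} {d : Fin L → ℕ} (hd : ∀ t, d t < b) :
    ∑ t, d t * b ^ (t : ℕ) < b ^ L := by
  have h := (finFunctionFinEquiv fun t => (⟨d t, hd t⟩ : Fin b)).isLt
  rwa [finFunctionFinEquiv_apply] at h

/-- UNIQUENESS OF DIGITS: two base-`b` expansions of length `L` with digits `< b` and the same value
have the same digits (injectivity of `finFunctionFinEquiv`). -/
theorem digits_injective {b L : ℕ} {d d' : Fin L → ℕ} (hd : ∀ t, d t < b) (hd' : ∀ t, d' t < b)
    (h : ∑ t, d t * b ^ (t : ℕ) = ∑ t, d' t * b ^ (t : ℕ)) : d = d' := by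
  have key : finFunctionFinEquiv (fun t => (⟨d t, hd t⟩ : Fin b)) =
      finFunctionFinEquiv (fun t => (⟨d' t, hd' t⟩ : Fin b)) := by
    apply Fin.ext
    rw [finFunctionFinEquiv_apply, finFunctionFinEquiv_apply]
    exact h
  have hfun := finFunctionFinEquiv.injective key
  funext t
  have ht := congrFun hfun t
  rw [Fin.mk.injEq] at ht
  exact ht

/-! ## The digit map reflects two-fold sums -/

/-- **The radix-`2m` digit map reflects two-fold sums.**  For `x : Fin L → ℤ/m` put
`Φ x = Σ_t val(x t) · (2m)^t  (mod p)` with `(2m)^L < p`.  If `Φ x + Φ y = Φ x' + Φ y'` in `ℤ/p` then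
`x + y = x' + y'` in `(ℤ/m)^L`: both sides are casts of base-`2m` expansions with digits
`val(x t) + val(y t) ≤ 2m - 2 < 2m`, hence of naturals `< (2m)^L < p`, so the naturals agree, so the
digits agree (`digits_injective`), and casting the digit identity `val(x t) + val(y t) = val(x' t) + val(y' t)`
back into `ℤ/m` gives `x t + y t = x' t + y' t`. -/
theorem digitMap_reflect {m L p : ℕ} [NeZero m] (hp : (2 * m) ^ L < p)
    (Φ : (Fin L → ZMod m) → ZMod p)
    (hΦ : ∀ x, Φ x = ((∑ t, (x t).val * (2 * m) ^ (t : ℕ) : ℕ) : ZMod p))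
    (x y x' y' : Fin L → ZMod m) (h : Φ x + Φ y = Φ x' + Φ y') : x + y = x' + y' := by
  -- the digits of a two-fold sum
  have hdig : ∀ u v : Fin L → ZMod m, ∀ t, (u t).val + (v t).val < 2 * m := fun u v t => by
    have h1 := ZMod.val_lt (u t)
    have h2 := ZMod.val_lt (v t)
    omega
  -- a two-fold sum of digit maps is the cast of the expansion with the summed digits
  have hsum : ∀ u v : Fin L → ZMod m,
      Φ u + Φ v = ((∑ t, ((u t).val + (v t).val) * (2 * m) ^ (t : ℕ) : ℕ) : ZMod p) := by
    intro u v
    rw [hΦ, hΦ, ← Nat.cast_add, ← Finset.sum_add_distrib]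
    congr 1
    exact Finset.sum_congr rfl fun t _ => (add_mul _ _ _).symm
  have hlt : ∀ u v : Fin L → ZMod m,
      ∑ t, ((u t).val + (v t).val) * (2 * m) ^ (t : ℕ) < p :=
    fun u v => (digits_lt (hdig u v)).trans hp
  rw [hsum, hsum] at h
  -- equal casts of naturals below `p` are equal naturals
  have hnat : ∑ t, ((x t).val + (y t).val) * (2 * m) ^ (t : ℕ) =
      ∑ t, ((x' t).val + (y' t).val) * (2 * m) ^ (t : ℕ) := by
    have h1 := (ZMod.natCast_eq_natCast_iff' _ _ _).1 h
    rwa [Nat.mod_eq_of_lt (hlt x y), Nat.mod_eq_of_lt (hlt x' y')] at h1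
  -- hence equal digits, hence equal coordinate sums in `ℤ/m`
  have hfun := digits_injective (hdig x y) (hdig x' y') hnat
  funext t
  have ht := congrArg (Nat.cast : ℕ → ZMod m) (congrFun hfun t)
  simp only [Nat.cast_add, ZMod.natCast_zmod_val] at ht
  simpa only [Pi.add_apply] using ht

/-! ## Digit designs are SDPP families -/

/-- **Digit designs satisfy the SDPP clauses.**  Let `(P c, Q c)_{c<r}` be DIRECT pairs in an abelian
group `G` (`(x - x') + (y - y') = 0` with `x, x' ∈ P c`, `y, y' ∈ Q c` forces `x = x'`, `y = y'`), let
`w₀, …, w_{n-1} : Fin L → Fin r` be words such that every ordered pair `wᵢ ≠ w_k` (`i ≠ k`) is STRONGLY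
SEPARATED in some coordinate `t` (the cross differences `Q (w_k t) - P (wᵢ t)` avoid every diagonal
difference set `Q c - P c`), and let `Φ : (Fin L → G) → K` reflect two-fold sums.  Then the image blocks
`A i = Φ '' ∏_t P (wᵢ t)`, `B i = Φ '' ∏_t Q (wᵢ t)` have `|A i| = ∏_t |P (wᵢ t)|`, `|B i| = ∏_t |Q (wᵢ t)|`
(`Φ` is injective) and satisfy (W) (coordinatewise directness) and (X): `(a - a') + (b - b') = 0` with
`a ∈ A i, a' ∈ A j, b ∈ B j, b' ∈ B k` pulls back to `x t + y t = x' t + y' t` for all `t`, and at a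
separating coordinate of `i ≠ k` this reads `y' t - x t = y t - x' t` — a cross difference of `(wᵢ, w_k)`
equal to a diagonal difference of the letter `w_j t`. -/
theorem digitDesign_sdpp {G K : Type*} [AddCommGroup G] [AddCommGroup K] [DecidableEq K]
    {r L n : ℕ} (P Q : Fin r → Finset G)
    (hD : ∀ c : Fin r, ∀ x ∈ P c, ∀ x' ∈ P c, ∀ y ∈ Q c, ∀ y' ∈ Q c,
      (x - x') + (y - y') = 0 → x = x' ∧ y = y')
    (w : Fin n → Fin L → Fin r)
    (hsep : ∀ i k : Fin n, i ≠ k → ∃ t : Fin L,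
      ∀ x ∈ P (w i t), ∀ y ∈ Q (w k t), ∀ c : Fin r, ∀ x' ∈ P c, ∀ y' ∈ Q c, y - x ≠ y' - x')
    (Φ : (Fin L → G) → K) (hΦ : ∀ a b a' b', Φ a + Φ b = Φ a' + Φ b' → a + b = a' + b')
    (A B : Fin n → Finset K)
    (hA : ∀ i, A i = (Fintype.piFinset fun t => P (w i t)).image Φ)
    (hB : ∀ i, B i = (Fintype.piFinset fun t => Q (w i t)).image Φ) :
    (∀ i, (A i).card = ∏ t, (P (w i t)).card ∧ (B i).card = ∏ t, (Q (w i t)).card) ∧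
    (∀ i : Fin n, ∀ a ∈ A i, ∀ a' ∈ A i, ∀ b ∈ B i, ∀ b' ∈ B i,
        (a - a') + (b - b') = 0 → a = a' ∧ b = b') ∧
    (∀ i j k : Fin n, ∀ a ∈ A i, ∀ a' ∈ A j, ∀ b ∈ B j, ∀ b' ∈ B k,
        (a - a') + (b - b') = 0 → i = k) := by
  -- a sum-reflecting map is injective
  have hinj : Function.Injective Φ := by
    intro a a' h
    have h2 : a + a = a' + a := hΦ a a a' a (by rw [h])
    exact add_right_cancel h2
  refine ⟨fun i => ⟨?_, ?_⟩, ?_, ?_⟩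
  · rw [hA, card_image_of_injective _ hinj, Fintype.card_piFinset]
  · rw [hB, card_image_of_injective _ hinj, Fintype.card_piFinset]
  · -- clause (W): coordinatewise directness
    intro i a ha a' ha' b hb b' hb' h0
    rw [hA] at ha ha'
    rw [hB] at hb hb'
    obtain ⟨x, hx, rfl⟩ := mem_image.1 ha
    obtain ⟨x', hx', rfl⟩ := mem_image.1 ha'
    obtain ⟨y, hy, rfl⟩ := mem_image.1 hb
    obtain ⟨y', hy', rfl⟩ := mem_image.1 hb'
    rw [Fintype.mem_piFinset] at hx hx' hy hy'
    have h2 : Φ x + Φ y = Φ x' + Φ y' := by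
      rw [← sub_eq_zero, ← h0]; abel
    have h3 := hΦ _ _ _ _ h2
    have key : ∀ t, x t = x' t ∧ y t = y' t := fun t =>
      hD (w i t) (x t) (hx t) (x' t) (hx' t) (y t) (hy t) (y' t) (hy' t) (by
        have e := congrFun h3 t
        simp only [Pi.add_apply] at e
        rw [← sub_eq_zero] at e
        rw [← e]; abel)
    obtain ⟨rfl, rfl⟩ : x = x' ∧ y = y' := ⟨funext fun t => (key t).1, funext fun t => (key t).2⟩
    exact ⟨rfl, rfl⟩
  · -- clause (X): strong separation at one coordinate
    intro i j k a ha a' ha' b hb b' hb' h0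
    by_contra hik
    obtain ⟨t, ht⟩ := hsep i k hik
    rw [hA] at ha ha'
    rw [hB] at hb hb'
    obtain ⟨x, hx, rfl⟩ := mem_image.1 ha
    obtain ⟨x', hx', rfl⟩ := mem_image.1 ha'
    obtain ⟨y, hy, rfl⟩ := mem_image.1 hb
    obtain ⟨y', hy', rfl⟩ := mem_image.1 hb'
    rw [Fintype.mem_piFinset] at hx hx' hy hy'
    have h2 : Φ x + Φ y = Φ x' + Φ y' := by
      rw [← sub_eq_zero, ← h0]; abel
    have h3 := congrFun (hΦ _ _ _ _ h2) t
    simp only [Pi.add_apply] at h3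
    refine ht (x t) (hx t) (y' t) (hy' t) (w j t) (x' t) (hx' t) (y t) (hy t) ?_
    rw [sub_eq_sub_iff_add_eq_add, add_comm (y' t) (x' t), add_comm (y t) (x t)]
    exact h3.symm

/-- `n ≤ |W|` elements of a finset, injectively indexed by `Fin n` (through `Finset.equivFin`). -/
theorem exists_injective_mem {α : Type*} (W : Finset α) {n : ℕ} (hn : n ≤ W.card) :
    ∃ w : Fin n → α, Function.Injective w ∧ ∀ i, w i ∈ W := by
  refine ⟨fun i => (W.equivFin.symm (Fin.castLE hn i) : W), fun i k hik => ?_,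
    fun i => (W.equivFin.symm _).2⟩
  exact Fin.castLE_injective hn (W.equivFin.symm.injective (Subtype.ext hik))

/-! ## Explicit exponent bookkeeping -/

/-- **Bookkeeping, explicit and uniform in the word length.**  Let `0 < δ ≤ 1`, `n₀³ ≤ m`,
`32^{4/δ} ≤ m`, `1 ≤ L`, a code size `N ≥ (m^L)^{1/2-δ/16}` and a host size `p ≤ 2 (2m)^L`.  Then
`n := max n₀ ⌈p^{1/(2+δ)}⌉₊` satisfies `n₀ ≤ n ≤ N`, `p ≤ n^{2+δ}` and `n^{2-δ} ≤ (m^{1-δ/16})^L`.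
Write `M = m^L`, `y = M^{1/2-δ/16}`, `g = (1/2-δ/16)(2+δ) - 1 = δ(6-δ)/16 ≥ δ/4`.  From
`32 ≤ m^{δ/4} ≤ m^g` we get `8 · 4^L ≤ 32^L ≤ M^g`, so `8p ≤ 8 · 4^L · M ≤ M^{g+1} = y^{2+δ}`, i.e.
`2 p^{1/(2+δ)} ≤ y`; with `2 ≤ y` this gives `⌈p^{1/(2+δ)}⌉₊ ≤ p^{1/(2+δ)} + 1 ≤ y`, and `n₀ ≤ y`
because `n₀³ ≤ m ≤ M ≤ y³`.  So `n ≤ y ≤ N`, and `n^{2-δ} ≤ y^{2-δ} = M^{(1/2-δ/16)(2-δ)} ≤ M^{1-δ/16}`. -/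
theorem digit_bookkeeping {δ : ℝ} (hδ : 0 < δ) (hδ1 : δ ≤ 1) {n₀ m L N p : ℕ}
    (hm₀ : n₀ ^ 3 ≤ m) (hmT : (32 : ℝ) ^ (4 / δ) ≤ m) (hL : 1 ≤ L)
    (hN : ((m : ℝ) ^ (L : ℝ)) ^ (1 / 2 - δ / 16) ≤ N) (hp : p ≤ 2 * (2 * m) ^ L) :
    ∃ n : ℕ, n₀ ≤ n ∧ n ≤ N ∧ (p : ℝ) ≤ (n : ℝ) ^ (2 + δ) ∧
      (n : ℝ) ^ (2 - δ) ≤ ((m : ℝ) ^ (1 - δ / 16)) ^ L := by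
  have h2δ : (0 : ℝ) < 2 + δ := by linarith
  have hL0 : L ≠ 0 := by omega
  -- `1 ≤ m`
  have hm1R : (1 : ℝ) ≤ m := (Real.one_le_rpow (by norm_num) (by positivity)).trans hmT
  have hm0R : (0 : ℝ) < m := one_pos.trans_le hm1R
  -- the real size `M = m ^ L ≥ m` of the lifted host, `y = M ^ (1/2 - δ/16)`, the gap exponent `g`
  obtain ⟨M, hM⟩ : ∃ M : ℝ, M = (m : ℝ) ^ L := ⟨_, rfl⟩
  have hMm : (m : ℝ) ≤ M := hM ▸ le_self_pow₀ hm1R hL0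
  have hM1 : 1 ≤ M := hm1R.trans hMm
  have hM0 : 0 < M := one_pos.trans_le hM1
  obtain ⟨y, hy⟩ : ∃ y : ℝ, y = M ^ (1 / 2 - δ / 16) := ⟨_, rfl⟩
  have hy0 : 0 < y := hy ▸ Real.rpow_pos_of_pos hM0 _
  have hyN : y ≤ N := by rwa [Real.rpow_natCast, ← hM, ← hy] at hN
  obtain ⟨g, hg⟩ : ∃ g : ℝ, g = (1 / 2 - δ / 16) * (2 + δ) - 1 := ⟨_, rfl⟩
  have hg4 : δ / 4 ≤ g := by
    rw [hg]; nlinarith [mul_nonneg hδ.le (by linarith : (0 : ℝ) ≤ 2 - δ)]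
  -- Step 1: `p ≤ 4^L · M`
  have hpR : (p : ℝ) ≤ 4 ^ L * M := by
    have h1 : (p : ℝ) ≤ 2 * (2 * m) ^ L := by exact_mod_cast hp
    have h2 : (2 : ℝ) ≤ 2 ^ L := by
      calc (2 : ℝ) = 2 ^ 1 := (pow_one _).symm
        _ ≤ 2 ^ L := pow_le_pow_right₀ one_le_two hL
    calc (p : ℝ) ≤ 2 * (2 * m) ^ L := h1
      _ = 2 * 2 ^ L * M := by rw [mul_pow, ← hM]; ring
      _ ≤ 2 ^ L * 2 ^ L * M :=
          mul_le_mul_of_nonneg_right (mul_le_mul_of_nonneg_right h2 (by positivity)) hM0.le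
      _ = 4 ^ L * M := by rw [← mul_pow]; norm_num
  -- Step 2: `32 ≤ m ^ (δ/4) ≤ m ^ g`, hence `8 · 4^L ≤ 32^L ≤ M ^ g`
  have h32 : (32 : ℝ) ≤ (m : ℝ) ^ (δ / 4) := by
    have e : ((32 : ℝ) ^ (4 / δ)) ^ (δ / 4) = 32 := by
      rw [← Real.rpow_mul (by norm_num), show 4 / δ * (δ / 4) = (1 : ℝ) by field_simp,
        Real.rpow_one]
    calc (32 : ℝ) = ((32 : ℝ) ^ (4 / δ)) ^ (δ / 4) := e.symm
      _ ≤ (m : ℝ) ^ (δ / 4) := Real.rpow_le_rpow (by positivity) hmT (by positivity)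
  have hmg : (32 : ℝ) ≤ (m : ℝ) ^ g := h32.trans (Real.rpow_le_rpow_of_exponent_le hm1R hg4)
  have hMg : (8 : ℝ) * 4 ^ L ≤ M ^ g := by
    have h8 : (8 : ℝ) ≤ 8 ^ L := by
      calc (8 : ℝ) = 8 ^ 1 := (pow_one _).symm
        _ ≤ 8 ^ L := pow_le_pow_right₀ (by norm_num) hL
    calc (8 : ℝ) * 4 ^ L ≤ 8 ^ L * 4 ^ L := mul_le_mul_of_nonneg_right h8 (by positivity)
      _ = 32 ^ L := by rw [← mul_pow]; norm_num
      _ ≤ ((m : ℝ) ^ g) ^ L := pow_le_pow_left₀ (by norm_num) hmg L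
      _ = M ^ g := by
          rw [← Real.rpow_mul_natCast hm0R.le, mul_comm, Real.rpow_natCast_mul hm0R.le, ← hM]
  -- Step 3: `8 p ≤ y ^ (2+δ)`
  have h8p : 8 * (p : ℝ) ≤ y ^ (2 + δ) := by
    calc 8 * (p : ℝ) ≤ 8 * (4 ^ L * M) := mul_le_mul_of_nonneg_left hpR (by norm_num)
      _ = (8 * 4 ^ L) * M := by ring
      _ ≤ M ^ g * M := mul_le_mul_of_nonneg_right hMg hM0.le
      _ = M ^ (g + 1) := (Real.rpow_add_one hM0.ne' g).symm
      _ = y ^ (2 + δ) := by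
          rw [hy, ← Real.rpow_mul hM0.le, hg]
          congr 1; ring
  -- Step 4: `x = p ^ (1/(2+δ))` has `2 x ≤ y` and `2 ≤ y`, so `⌈x⌉₊ ≤ y`; and `n₀ ≤ y`
  obtain ⟨x, hx⟩ : ∃ x : ℝ, x = (p : ℝ) ^ (2 + δ)⁻¹ := ⟨_, rfl⟩
  have hx0 : 0 ≤ x := hx ▸ Real.rpow_nonneg (Nat.cast_nonneg _) _
  have hxp : x ^ (2 + δ) = p := hx ▸ Real.rpow_inv_rpow (Nat.cast_nonneg _) h2δ.ne'
  have h2x : 2 * x ≤ y := by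
    have h23 : (2 : ℝ) ^ (2 + δ) ≤ 8 := by
      calc (2 : ℝ) ^ (2 + δ) ≤ (2 : ℝ) ^ ((3 : ℕ) : ℝ) :=
            Real.rpow_le_rpow_of_exponent_le one_le_two (by push_cast; linarith)
        _ = 8 := by rw [Real.rpow_natCast]; norm_num
    have h : (2 * x) ^ (2 + δ) ≤ y ^ (2 + δ) := by
      rw [Real.mul_rpow zero_le_two hx0, hxp]
      calc (2 : ℝ) ^ (2 + δ) * p ≤ 8 * p := mul_le_mul_of_nonneg_right h23 (Nat.cast_nonneg _)
        _ ≤ y ^ (2 + δ) := h8p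
    exact (Real.rpow_le_rpow_iff (by positivity) hy0.le h2δ).1 h
  have h2y : 2 ≤ y := by
    calc (2 : ℝ) ≤ 32 := by norm_num
      _ ≤ (m : ℝ) ^ (δ / 4) := h32
      _ ≤ (m : ℝ) ^ (1 / 2 - δ / 16) := Real.rpow_le_rpow_of_exponent_le hm1R (by linarith)
      _ ≤ M ^ (1 / 2 - δ / 16) := Real.rpow_le_rpow hm0R.le hMm (by linarith)
      _ = y := hy.symm
  have hceil : (⌈x⌉₊ : ℝ) ≤ y := by
    have h1 := Nat.ceil_lt_add_one hx0
    linarith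
  have hn₀y : (n₀ : ℝ) ≤ y := by
    have h3 : (n₀ : ℝ) ^ 3 ≤ y ^ 3 := by
      calc (n₀ : ℝ) ^ 3 ≤ m := by exact_mod_cast hm₀
        _ ≤ M := hMm
        _ = M ^ (1 : ℝ) := (Real.rpow_one _).symm
        _ ≤ M ^ ((1 / 2 - δ / 16) * ((3 : ℕ) : ℝ)) :=
            Real.rpow_le_rpow_of_exponent_le hM1 (by push_cast; linarith)
        _ = y ^ 3 := by rw [Real.rpow_mul_natCast hM0.le, ← hy]
    exact le_of_pow_le_pow_left₀ (by norm_num) hy0.le h3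
  have hnR : ((max n₀ ⌈x⌉₊ : ℕ) : ℝ) ≤ y := by
    rw [Nat.cast_max]
    exact max_le hn₀y hceil
  -- the number of pairs kept
  refine ⟨max n₀ ⌈x⌉₊, le_max_left _ _, ?_, ?_, ?_⟩
  · -- `n ≤ N`
    exact_mod_cast hnR.trans hyN
  · -- `p ≤ n ^ (2+δ)`
    have hxn : x ≤ ((max n₀ ⌈x⌉₊ : ℕ) : ℝ) :=
      (Nat.le_ceil x).trans (by exact_mod_cast le_max_right n₀ ⌈x⌉₊)
    calc (p : ℝ) = x ^ (2 + δ) := hxp.symm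
      _ ≤ ((max n₀ ⌈x⌉₊ : ℕ) : ℝ) ^ (2 + δ) := Real.rpow_le_rpow hx0 hxn h2δ.le
  · -- `n ^ (2-δ) ≤ (m ^ (1-δ/16)) ^ L`
    calc ((max n₀ ⌈x⌉₊ : ℕ) : ℝ) ^ (2 - δ) ≤ y ^ (2 - δ) :=
          Real.rpow_le_rpow (Nat.cast_nonneg _) hnR (by linarith)
      _ = M ^ ((1 / 2 - δ / 16) * (2 - δ)) := by rw [hy, ← Real.rpow_mul hM0.le]
      _ ≤ M ^ (1 - δ / 16) := Real.rpow_le_rpow_of_exponent_le hM1 (by nlinarith)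
      _ = ((m : ℝ) ^ (1 - δ / 16)) ^ L := by
          rw [hM, ← Real.rpow_natCast_mul hm0R.le, mul_comm, Real.rpow_mul_natCast hm0R.le]

/-! ## The registered stub -/

/-- **Stub `stub_capacityTransfer` (line `Sketch`, capacity form): capacity gadgets give every slice
`0 < δ ≤ 1` of the crux `PrimeTwoFamilies`.**  Suppose that for every `ε > 0` there are arbitrarily
large `m`, direct pairs `(P c, Q c)_{c<r}` in `ZMod m` with `m^{1-ε} ≤ |P c||Q c|`, and a zero-error code
`W` of words `Fin L → Fin r` (`1 ≤ L`, every ordered pair of distinct words strongly separated in some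
coordinate) with `(m^L)^{1/2-ε} ≤ |W|`.  Then `PrimeTwoFamiliesAt δ`.

Explicit proof.  Take `ε = δ/16` and a gadget level `m ≥ max (n₀³) ⌈32^{4/δ}⌉₊`; let `p` be a prime with
`(2m)^L < p ≤ 2(2m)^L` (Bertrand); let `n = max n₀ ⌈p^{1/(2+δ)}⌉₊ ≤ |W|` (`digit_bookkeeping`) and pick
`n` distinct code words `w₀, …, w_{n-1}` (`exists_injective_mem`).  The family is the radix-`2m` DIGIT
DESIGN `A i = { Σ_t val(x_t)(2m)^t mod p : x_t ∈ P (wᵢ t) }`, `B i = { Σ_t val(y_t)(2m)^t mod p : y_t ∈ Q (wᵢ t) }`: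
the digit map reflects two-fold sums (`digitMap_reflect`), so the pairs are SDPP of co-volume
`∏_t |P (wᵢ t)||Q (wᵢ t)| ≥ (m^{1-ε})^L ≥ n^{2-δ}` (`digitDesign_sdpp`), and `p ≤ n^{2+δ}`. -/
theorem stub_capacityTransfer
    (h : ∀ ε : ℝ, 0 < ε → ∀ m₀ : ℕ, ∃ m ≥ m₀, ∃ r L : ℕ, ∃ P Q : Fin r → Finset (ZMod m),
      ∃ W : Finset (Fin L → Fin r),
        (∀ c : Fin r, ∀ x ∈ P c, ∀ x' ∈ P c, ∀ y ∈ Q c, ∀ y' ∈ Q c,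
            (x - x') + (y - y') = 0 → x = x' ∧ y = y') ∧
        (∀ i ∈ W, ∀ k ∈ W, i ≠ k → ∃ t : Fin L,
            ∀ x ∈ P (i t), ∀ y ∈ Q (k t), ∀ c : Fin r, ∀ x' ∈ P c, ∀ y' ∈ Q c, y - x ≠ y' - x') ∧
        1 ≤ L ∧ ((m : ℝ) ^ (L : ℝ)) ^ (1 / 2 - ε) ≤ (W.card : ℝ) ∧
        ∀ c : Fin r, (m : ℝ) ^ (1 - ε) ≤ (((P c).card * (Q c).card : ℕ) : ℝ))
    {δ : ℝ} (hδ : 0 < δ) (hδ1 : δ ≤ 1) : PrimeTwoFamiliesAt δ := by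
  classical
  intro n₀
  -- a gadget level above the explicit threshold `max (n₀³) ⌈32^{4/δ}⌉₊`, with `ε = δ/16`
  obtain ⟨m, hm, r, L, P, Q, W, hD, hC, hL, hWcard, hPQ⟩ :=
    h (δ / 16) (by positivity) (max (n₀ ^ 3) ⌈(32 : ℝ) ^ (4 / δ)⌉₊)
  have hm₀ : n₀ ^ 3 ≤ m := le_trans (le_max_left _ _) hm
  have hmT : (32 : ℝ) ^ (4 / δ) ≤ m :=
    (Nat.le_ceil _).trans (by exact_mod_cast le_trans (le_max_right _ _) hm)
  have hm1 : 1 ≤ m := by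
    have h1 : (1 : ℝ) ≤ m := (Real.one_le_rpow (by norm_num) (by positivity)).trans hmT
    exact_mod_cast h1
  haveI : NeZero m := ⟨by omega⟩
  -- a Bertrand prime above `(2m)^L`
  obtain ⟨p, hp, hltp, hp2⟩ :=
    Nat.exists_prime_lt_and_le_two_mul ((2 * m) ^ L) (pow_pos (by omega) L).ne'
  -- the number of pairs kept and the code words used
  obtain ⟨n, hn₀, hnN, hpn, hnP⟩ := digit_bookkeeping hδ hδ1 hm₀ hmT hL hWcard hp2
  obtain ⟨w, hwinj, hwmem⟩ := exists_injective_mem W hnN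
  have hsep : ∀ i k : Fin n, i ≠ k → ∃ t : Fin L,
      ∀ x ∈ P (w i t), ∀ y ∈ Q (w k t), ∀ c : Fin r, ∀ x' ∈ P c, ∀ y' ∈ Q c, y - x ≠ y' - x' :=
    fun i k hik => hC (w i) (hwmem i) (w k) (hwmem k) fun e => hik (hwinj e)
  -- the radix-`2m` digit map and the digit design
  obtain ⟨Φ, hΦ⟩ : ∃ Φ : (Fin L → ZMod m) → ZMod p,
      ∀ x, Φ x = ((∑ t, (x t).val * (2 * m) ^ (t : ℕ) : ℕ) : ZMod p) := ⟨_, fun _ => rfl⟩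
  have hrefl := digitMap_reflect hltp Φ hΦ
  obtain ⟨A, hA⟩ : ∃ A : Fin n → Finset (ZMod p),
      ∀ i, A i = (Fintype.piFinset fun t => P (w i t)).image Φ := ⟨_, fun _ => rfl⟩
  obtain ⟨B, hB⟩ : ∃ B : Fin n → Finset (ZMod p),
      ∀ i, B i = (Fintype.piFinset fun t => Q (w i t)).image Φ := ⟨_, fun _ => rfl⟩
  obtain ⟨hcard, hW', hX'⟩ := digitDesign_sdpp P Q hD w hsep Φ hrefl A B hA hB
  refine ⟨n, hn₀, p, hp, A, B, hW', hX', hpn, fun i => ?_⟩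
  -- co-volume: `n^{2-δ} ≤ (m^{1-δ/16})^L ≤ ∏_t |P (wᵢ t)||Q (wᵢ t)| = |A i||B i|`
  rw [(hcard i).1, (hcard i).2, ← Finset.prod_mul_distrib]
  refine hnP.trans ?_
  rw [← Fin.prod_const]
  push_cast
  exact Finset.prod_le_prod (fun t _ => by positivity) fun t _ => by exact_mod_cast hPQ (w i t)

end Summit.MatrixMultiplication.MatrixMultiplication.Theorems.PrimeTwoFamilies.DigitTransfer
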